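import Literature.RingTheory.MvPolynomial.HilbertPolynomialExists
import Mathlib.Algebra.Algebra.Operations
import Mathlib.RingTheory.Polynomial.Basic
import HarnessLib

/-!
# Affine Hilbert functions: growth of the powers of a subspace modulo an ideal

Topic `Literature/RingTheory/GradedAlgebra`. Let `A` be a commutative algebra over a field `K`,
`V ⊆ A` a finitely generated `K`-subspace and `𝔟 ⊆ A` an ideal. The **affine Hilbert function**
of `𝔟` with respect to `V` is `k ↦ dim_K V^k - dim_K (V^k ∩ 𝔟)`, the dimension of the image of
`V^k` in `A/𝔟` (Kollár / Chardin's "Hilbert functions as dimensions of linear systems", cf.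
Nesterenko–Philippon (eds.), LNM 1752, Ch. 9 §1; for `V = K ⊕ {linear forms}` of `K[x]` it is the
classical affine Hilbert function, Cox–Little–O'Shea Ch. 9 §3). PROVED here:

* `affHilbertFun V 𝔟 k = dim_K V^k - dim_K (V^k ∩ 𝔟)`, antitone in `𝔟`;
* **`isEventuallyPoly_affHilbertFun`** — it agrees with a polynomial for large `k`.

The proof transports to the existence of the Hilbert polynomial of a homogeneous ideal of
`K[X₀, …, X_{N-1}]` (`Literature.RingTheory.MvPolynomial.exists_hilbertPolynomial`,
`HilbertPolynomialExists.lean`, with `idealDegree` of `LeadingExponents.lean`): for a spanning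
family `v : ι → A` of `V` the graded homomorphism `ψ : K[Xᵢ] → A[T]`, `Xᵢ ↦ vᵢ T`, maps forms of
degree `k` to `(φ p) T^k` with `φ = aeval v`, `φ(K[X]_k) = V^k` (`map_aeval_homogeneousSubmodule`),
and `𝔍 = ψ⁻¹(𝔟 A[T])` is a homogeneous ideal with `𝔍_k = φ⁻¹(𝔟) ∩ K[X]_k`, so that
`dim K[X]_k - dim 𝔍_k = affHilbertFun V 𝔟 k` by rank–nullity (`hilbert_transportIdeal`).
`IsEventuallyPoly f` names "agrees with a rational polynomial for all large arguments".

## References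

* Yu. V. Nesterenko, P. Philippon (eds.), *Introduction to Algebraic Independence Theory*, LNM 1752
  (2001), Ch. 9 (geometric Hilbert functions as dimensions of linear systems), Ch. 11 §2.2.
* D. Cox, J. Little, D. O'Shea, *Ideals, Varieties, and Algorithms*, Ch. 9 §3 (affine Hilbert
  function).
-/

noncomputable section

open Module MvPolynomial Literature.RingTheory.MvPolynomial

namespace Literature.RingTheory.GradedAlgebra

attribute [local instance] MvPolynomial.gradedAlgebra

/-- `f : ℕ → ℕ` is *eventually polynomial*: it agrees with a rational polynomial for all large
arguments. [folklore] -/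
def IsEventuallyPoly (f : ℕ → ℕ) : Prop :=
  ∃ p : Polynomial ℚ, ∃ k₀ : ℕ, ∀ k, k₀ ≤ k → (f k : ℚ) = p.eval (k : ℚ)

/-- Eventually equal functions are eventually polynomial together. [folklore] -/
theorem IsEventuallyPoly.congr {f g : ℕ → ℕ} (hf : IsEventuallyPoly f) {k₁ : ℕ}
    (h : ∀ k, k₁ ≤ k → f k = g k) : IsEventuallyPoly g := by
  obtain ⟨p, k₀, hp⟩ := hf
  exact ⟨p, max k₀ k₁, fun k hk => by
    rw [← h k (le_of_max_le_right hk), hp k (le_of_max_le_left hk)]⟩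

variable {K : Type*} [Field K] {A : Type*} [CommRing A] [Algebra K A]

/-- **The affine Hilbert function** of the ideal `𝔟` with respect to the subspace `V`:
`k ↦ dim_K V^k - dim_K (V^k ∩ 𝔟)` (`= dim_K` of the image of `V^k` in `A/𝔟`).
[cite: NesterenkoPhilippon2001, Ch. 9 §1] -/
def affHilbertFun (V : Submodule K A) (𝔟 : Ideal A) (k : ℕ) : ℕ :=
  finrank K ↥(V ^ k) - finrank K ↥(V ^ k ⊓ Submodule.restrictScalars K 𝔟)

/-- The affine Hilbert function is antitone in the ideal. [folklore] -/
theorem affHilbertFun_mono (V : Submodule K A) {𝔟 𝔟' : Ideal A} (h : 𝔟 ≤ 𝔟') (k : ℕ)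
    [Module.Finite K ↥(V ^ k)] : affHilbertFun V 𝔟' k ≤ affHilbertFun V 𝔟 k := by
  haveI : Module.Finite K ↥(V ^ k ⊓ Submodule.restrictScalars K 𝔟') :=
    Module.Finite.of_injective (Submodule.inclusion inf_le_left) (Submodule.inclusion_injective _)
  have hle : finrank K ↥(V ^ k ⊓ Submodule.restrictScalars K 𝔟) ≤
      finrank K ↥(V ^ k ⊓ Submodule.restrictScalars K 𝔟') :=
    Submodule.finrank_mono (inf_le_inf_left (V ^ k) fun x hx => h hx)
  unfold affHilbertFun
  omega

/-- `affHilbertFun V 𝔟 k ≤ dim V^k`. [folklore] -/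
theorem affHilbertFun_le (V : Submodule K A) (𝔟 : Ideal A) (k : ℕ) :
    affHilbertFun V 𝔟 k ≤ finrank K ↥(V ^ k) :=
  Nat.sub_le _ _

/-! ### Transport to a homogeneous ideal of a polynomial ring -/

section Transport

variable {ι : Type*} (v : ι → A)

/-- Products of elements of powers of `V` lie in the power with the summed exponent. [folklore] -/
theorem prod_mem_pow {V : Submodule K A} {α : Type*} (t : Finset α) (f : α → A) (e : α → ℕ)
    (h : ∀ a ∈ t, f a ∈ V ^ e a) : ∏ a ∈ t, f a ∈ V ^ ∑ a ∈ t, e a := by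
  classical
  induction t using Finset.induction_on with
  | empty =>
    simp only [Finset.prod_empty, Finset.sum_empty, pow_zero]
    exact Submodule.one_le.mp le_rfl
  | insert a t ha ih =>
    rw [Finset.prod_insert ha, Finset.sum_insert ha, pow_add]
    exact Submodule.mul_mem_mul (h a (Finset.mem_insert_self a t))
      (ih fun b hb => h b (Finset.mem_insert_of_mem hb))

/-- The evaluation `φ = aeval v` maps forms of degree `k` into `V^k` for `V = span (range v)`.
[folklore] -/
theorem aeval_mem_pow_of_isHomogeneous {p : MvPolynomial ι K} {k : ℕ} (hp : p.IsHomogeneous k) :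
    aeval v p ∈ Submodule.span K (Set.range v) ^ k := by
  classical
  rw [p.as_sum, map_sum]
  refine Submodule.sum_mem _ fun d hd => ?_
  rw [aeval_monomial, Algebra.algebraMap_eq_smul_one, smul_mul_assoc, one_mul]
  refine Submodule.smul_mem _ _ ?_
  have hdeg : d.degree = k := by
    rw [Finsupp.degree_eq_weight_one]
    exact hp (mem_support_iff.mp hd)
  rw [← hdeg, Finsupp.degree_apply, Finsupp.prod]
  exact prod_mem_pow _ _ _ fun i _ =>
    Submodule.pow_mem_pow _ (Submodule.subset_span (Set.mem_range_self i)) _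

/-- **`φ(K[X]_k) = V^k`**: the forms of degree `k` in the variables `Xᵢ` evaluate onto the `k`-th
power of `V = span (range v)`. [folklore] -/
theorem map_aeval_homogeneousSubmodule (k : ℕ) :
    (homogeneousSubmodule ι K k).map (aeval v).toLinearMap = Submodule.span K (Set.range v) ^ k := by
  apply le_antisymm
  · rintro _ ⟨p, hp, rfl⟩
    exact aeval_mem_pow_of_isHomogeneous v ((mem_homogeneousSubmodule k p).mp hp)
  · intro x hx
    refine Submodule.pow_induction_on_left' (Submodule.span K (Set.range v))
      (C := fun n x _ => x ∈ (homogeneousSubmodule ι K n).map (aeval v).toLinearMap)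
      (fun r => ?_) (fun x y i _ _ hx hy => Submodule.add_mem _ hx hy) (fun m hm i x _ hx => ?_) hx
    · exact ⟨MvPolynomial.C r, (mem_homogeneousSubmodule 0 _).mpr (isHomogeneous_C ι r), by simp⟩
    · obtain ⟨q, hq, rfl⟩ := hx
      -- `m ∈ V` is the value of a linear form
      have hm' : m ∈ (homogeneousSubmodule ι K 1).map (aeval v).toLinearMap := by
        refine Submodule.span_le.mpr ?_ hm
        rintro _ ⟨i, rfl⟩
        exact ⟨X i, (mem_homogeneousSubmodule 1 _).mpr (isHomogeneous_X K i), by simp⟩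
      obtain ⟨ℓ, hℓ, rfl⟩ := hm'
      refine ⟨ℓ * q, (mem_homogeneousSubmodule _ _).mpr ?_, by simp⟩
      have h := ((mem_homogeneousSubmodule 1 ℓ).mp hℓ).mul ((mem_homogeneousSubmodule i q).mp hq)
      rwa [add_comm] at h

/-- The graded homomorphism `ψ : K[Xᵢ] → A[T]`, `Xᵢ ↦ vᵢ · T`. [folklore] -/
def homogenizeHom : MvPolynomial ι K →ₐ[K] Polynomial A :=
  aeval fun i => Polynomial.C (v i) * Polynomial.X

/-- On forms of degree `k`, `ψ p = (φ p) · T^k`. [folklore] -/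
theorem homogenizeHom_of_isHomogeneous {p : MvPolynomial ι K} {k : ℕ} (hp : p.IsHomogeneous k) :
    homogenizeHom v p = Polynomial.C (aeval v p) * Polynomial.X ^ k := by
  classical
  rw [p.as_sum, map_sum, map_sum, map_sum, Finset.sum_mul]
  refine Finset.sum_congr rfl fun d hd => ?_
  have hdeg : d.degree = k := by
    rw [Finsupp.degree_eq_weight_one]
    exact hp (mem_support_iff.mp hd)
  rw [homogenizeHom, aeval_monomial, aeval_monomial]
  simp only [Finsupp.prod, mul_pow, Finset.prod_mul_distrib, Finset.prod_pow_eq_pow_sum, ← map_pow,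
    ← map_prod, map_mul, Polynomial.algebraMap_apply]
  rw [← Finsupp.degree_apply, hdeg]
  ring

/-- The **transport ideal** `𝔍 = ψ⁻¹(𝔟 A[T]) ⊆ K[Xᵢ]`. [folklore] -/
def transportIdeal (𝔟 : Ideal A) : Ideal (MvPolynomial ι K) :=
  Ideal.comap (homogenizeHom v) (𝔟.map (Polynomial.C : A →+* Polynomial A))

/-- Coefficients of `ψ p`: the `n`-th coefficient is `φ` of the degree-`n` component of `p`.
[folklore] -/
theorem coeff_homogenizeHom (p : MvPolynomial ι K) (n : ℕ) :
    (homogenizeHom v p).coeff n = aeval v (homogeneousComponent n p) := by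
  classical
  conv_lhs => rw [← sum_homogeneousComponent p, map_sum]
  rw [Polynomial.finsetSum_coeff]
  simp_rw [homogenizeHom_of_isHomogeneous v (homogeneousComponent_isHomogeneous _ p),
    Polynomial.coeff_C_mul_X_pow]
  rw [Finset.sum_ite_eq]
  split_ifs with h
  · rfl
  · rw [homogeneousComponent_eq_zero _ _ (by rw [Finset.mem_range] at h; omega), map_zero]

/-- Membership in the transport ideal: `p ∈ 𝔍 ↔ φ(p_n) ∈ 𝔟` for every `n`. [folklore] -/
theorem mem_transportIdeal_iff {𝔟 : Ideal A} {p : MvPolynomial ι K} :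
    p ∈ transportIdeal v 𝔟 ↔ ∀ n, aeval v (homogeneousComponent n p) ∈ 𝔟 := by
  simp only [transportIdeal, Ideal.mem_comap, Ideal.mem_map_C_iff, coeff_homogenizeHom]

/-- For a form `p` of degree `k`: `p ∈ 𝔍 ↔ φ p ∈ 𝔟`. [folklore] -/
theorem mem_transportIdeal_iff_of_isHomogeneous {𝔟 : Ideal A} {p : MvPolynomial ι K} {k : ℕ}
    (hp : p.IsHomogeneous k) : p ∈ transportIdeal v 𝔟 ↔ aeval v p ∈ 𝔟 := by
  rw [mem_transportIdeal_iff]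
  constructor
  · intro h
    simpa [homogeneousComponent_eq_self hp] using h k
  · intro h n
    rw [homogeneousComponent_of_mem hp]
    split_ifs
    · exact h
    · simp

/-- The transport ideal is homogeneous. [folklore] -/
theorem isHomogeneous_transportIdeal (𝔟 : Ideal A) :
    (transportIdeal v 𝔟).IsHomogeneous (homogeneousSubmodule ι K) := by
  intro i p hp
  rw [← DirectSum.Decomposition.decompose'_eq, decomposition.decompose'_apply,
    mem_transportIdeal_iff_of_isHomogeneous v (homogeneousComponent_isHomogeneous i p)]
  exact (mem_transportIdeal_iff v).mp hp i

/-- **The transport identity**: the Hilbert function `dim K[X]_k - dim 𝔍_k` of `𝔍` is the affine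
Hilbert function of `𝔟` with respect to `V = span (range v)` (rank–nullity for `φ : K[X]_k ↠ V^k`,
whose restriction to `𝔍_k = φ⁻¹(𝔟) ∩ K[X]_k` has the same kernel and image `V^k ∩ 𝔟`).
[folklore] -/
theorem hilbert_transportIdeal [Fintype ι] (𝔟 : Ideal A) (k : ℕ) :
    finrank K (homogeneousSubmodule ι K k) - finrank K (idealDegree (transportIdeal (K := K) v 𝔟) k) =
      affHilbertFun (Submodule.span K (Set.range v)) 𝔟 k := by
  set V := Submodule.span K (Set.range v) with hV
  set Rk := homogeneousSubmodule ι K k with hRk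
  set Dk := idealDegree (transportIdeal (K := K) v 𝔟) k with hDk
  set φ : MvPolynomial ι K →ₗ[K] A := (aeval (R := K) v).toLinearMap with hφ
  have hmemDk : ∀ p, p ∈ Dk ↔ p ∈ Rk ∧ φ p ∈ 𝔟 := fun p => by
    rw [hDk, mem_idealDegree, hRk, mem_homogeneousSubmodule]
    constructor
    · rintro ⟨hp, hpk⟩
      exact ⟨hpk, (mem_transportIdeal_iff_of_isHomogeneous v hpk).mp hp⟩
    · rintro ⟨hpk, hp⟩
      exact ⟨(mem_transportIdeal_iff_of_isHomogeneous v hpk).mpr hp, hpk⟩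
  -- the common kernel
  set W₀ : Submodule K (MvPolynomial ι K) := Rk ⊓ LinearMap.ker φ with hW₀
  -- `φ` on the forms of degree `k`: range `V^k`
  set f : Rk →ₗ[K] A := φ.comp Rk.subtype with hf
  have hrange : LinearMap.range f = V ^ k := by
    rw [hf, LinearMap.range_comp, Submodule.range_subtype, hφ, map_aeval_homogeneousSubmodule v k]
  have hker : (LinearMap.ker f).map Rk.subtype = W₀ := by
    ext p
    simp only [Submodule.mem_map, LinearMap.mem_ker, hf, LinearMap.comp_apply,
      Submodule.coe_subtype, hW₀, Submodule.mem_inf]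
    constructor
    · rintro ⟨q, hq, rfl⟩
      exact ⟨q.2, hq⟩
    · rintro ⟨hp, hp0⟩
      exact ⟨⟨p, hp⟩, hp0, rfl⟩
  -- `φ` on `𝔍_k`: range `V^k ∩ 𝔟`, same kernel
  set f' : Dk →ₗ[K] A := φ.comp Dk.subtype with hf'
  have hrange' : LinearMap.range f' = V ^ k ⊓ Submodule.restrictScalars K 𝔟 := by
    ext a
    simp only [LinearMap.mem_range, hf', LinearMap.comp_apply, Submodule.coe_subtype,
      Submodule.mem_inf, Submodule.restrictScalars_mem]
    constructor
    · rintro ⟨q, rfl⟩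
      obtain ⟨hq1, hq2⟩ := (hmemDk q).mp q.2
      exact ⟨hrange ▸ LinearMap.mem_range_self f ⟨q, hq1⟩, hq2⟩
    · rintro ⟨ha, hab⟩
      obtain ⟨q, rfl⟩ := (hrange ▸ ha : a ∈ LinearMap.range f)
      exact ⟨⟨q, (hmemDk q).mpr ⟨q.2, hab⟩⟩, rfl⟩
  have hker' : (LinearMap.ker f').map Dk.subtype = W₀ := by
    ext p
    simp only [Submodule.mem_map, LinearMap.mem_ker, hf', LinearMap.comp_apply,
      Submodule.coe_subtype, hW₀, Submodule.mem_inf]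
    constructor
    · rintro ⟨q, hq, rfl⟩
      exact ⟨((hmemDk q).mp q.2).1, hq⟩
    · rintro ⟨hp, hp0⟩
      refine ⟨⟨p, (hmemDk p).mpr ⟨hp, ?_⟩⟩, hp0, rfl⟩
      rw [LinearMap.mem_ker.mp hp0]
      exact 𝔟.zero_mem
  haveI : Module.Finite K Rk := Module.Finite.iff_fg.mpr (homogeneousSubmodule_fg ι K k)
  have h1 := LinearMap.finrank_range_add_finrank_ker f
  have h2 := LinearMap.finrank_range_add_finrank_ker f'
  rw [hrange, ← Submodule.finrank_map_subtype_eq Rk (LinearMap.ker f), hker] at h1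
  rw [hrange', ← Submodule.finrank_map_subtype_eq Dk (LinearMap.ker f'), hker'] at h2
  rw [affHilbertFun, ← h1, ← h2, Nat.add_sub_add_right]

end Transport

/-- **The affine Hilbert function is eventually polynomial**: for a finitely generated subspace
`V` of a commutative algebra over a field and any ideal `𝔟`, `k ↦ dim_K V^k - dim_K (V^k ∩ 𝔟)`
agrees with a polynomial for all large `k` (transport to the Hilbert polynomial of the homogeneous
ideal `𝔍 ⊆ K[X₀, …, X_{N-1}]`, `Literature.RingTheory.MvPolynomial.exists_hilbertPolynomial`).
[cite: NesterenkoPhilippon2001, Ch. 11 §2.2] -/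
theorem isEventuallyPoly_affHilbertFun {V : Submodule K A} (hV : V.FG) (𝔟 : Ideal A) :
    IsEventuallyPoly (affHilbertFun V 𝔟) := by
  obtain ⟨s, rfl⟩ := hV
  -- enumerate the spanning set by `Fin s.card`
  set v : Fin s.card → A := fun i => ((s.equivFin.symm i : s) : A) with hv
  have hrange : Set.range v = (s : Set A) := by
    ext a
    simp only [Set.mem_range, hv, Finset.mem_coe]
    constructor
    · rintro ⟨i, rfl⟩
      exact (s.equivFin.symm i).2
    · intro ha
      exact ⟨s.equivFin ⟨a, ha⟩, by simp⟩
  obtain ⟨p, t₀, hp⟩ := exists_hilbertPolynomial (transportIdeal (K := K) v 𝔟)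
    (isHomogeneous_transportIdeal v 𝔟)
  refine ⟨p, t₀, fun k hk => ?_⟩
  rw [← hp k hk, hilbert_transportIdeal, hrange]

end Literature.RingTheory.GradedAlgebra
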